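import Literature.NumberTheory.Automorphic.OrdinaryCompletedCohomologyGL
import Literature.Algebra.Homology.GroupCohomologyCentralElement
import HarnessLib

/-!
# Hecke operators of global central elements are the identity

Generic part (`ArithmeticQuotient`, `H^i(X_L, M) = H^i(Γ, Fun(𝒢 ⧸ L, M))`): if `γ ∈ Z(Γ)` has
central image `ι γ ∈ Z(𝒢)`, the action of `γ` on the coefficients `Fun(𝒢 ⧸ L, M)` IS the Hecke
(double-coset) operator of the normalising element `(ι γ)⁻¹` (right translation,
`heckeFun_apply_mk_of_conj`), so by the triviality of central elements on group cohomology
(`map_eq_id_of_central`) the Hecke operators `T_{(ι γ)^{±1}}` are the IDENTITY on every `H^i(X_L, M)`.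

`GL_n` part: for a global scalar `u ∈ Kˣ`, the diagonal `γ = u · 1 ∈ GL_n(K)` is central with central
image in `GL_n(𝔸_K^∞)`, so its Hecke family along the Hida tower of any tame level is `1`
(`hidaFamily_globalEmbedding_scalar`) — the input "global central elements act trivially on
`H^•(GL_n(K), ·)`" of the diamond-weight computation. [folklore]
-/

open Literature.NumberTheory.Automorphic Literature.NumberTheory.Automorphic.BigHeckeGLn
open CategoryTheory Literature.Algebra.Homology

namespace Literature.NumberTheory.Automorphic

section Generic

variable (k : Type) [CommRing k] {Γ 𝒢 : Type} [Group Γ] [Group 𝒢] (ι : Γ →* 𝒢) (L : Subgroup 𝒢)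
  (M : Type) [AddCommGroup M] [Module k M]

/-- A central element normalises every subgroup (in the form used by the Hecke lemmas). [folklore] -/
theorem conj_mem_of_mem_center {g : 𝒢} (hg : g ∈ Subgroup.center 𝒢) (l : 𝒢) (hl : l ∈ L) :
    g⁻¹ * l * g ∈ L := by
  rwa [mul_assoc, Subgroup.mem_center_iff.1 hg l, inv_mul_cancel_left]

/-- For `γ ∈ Γ` with central image `ι γ ∈ Z(𝒢)`, the action of `γ` on `Fun(𝒢 ⧸ L, M)`
(`(γ f)(xL) = f((ι γ)⁻¹ x L)`) is the Hecke operator of `(ι γ)⁻¹` (`= f(x (ι γ)⁻¹ L)`). [folklore] -/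
theorem heckeRepHom_hom_apply_of_central {γ : Γ} (hγ : ι γ ∈ Subgroup.center 𝒢) (f : (𝒢 ⧸ L) → M) :
    (ArithmeticQuotient.heckeRepHom k L (ι γ)⁻¹ M ι).hom f =
      (ArithmeticQuotient.coeffRep k ι L M).ρ γ f := by
  have hconj : ∀ l ∈ L, ((ι γ)⁻¹)⁻¹ * l * (ι γ)⁻¹ ∈ L :=
    conj_mem_of_mem_center L (inv_mem hγ)
  funext c
  induction c using QuotientGroup.induction_on with
  | H x =>
    rw [ArithmeticQuotient.heckeRepHom_hom_apply, ArithmeticQuotient.heckeFun_apply_mk_of_conj k M hconj f x]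
    change _ = ArithmeticQuotient.coeffRepresentation k ι L M γ f (x : 𝒢 ⧸ L)
    rw [ArithmeticQuotient.coeffRepresentation_apply, MulAction.Quotient.smul_coe, smul_eq_mul,
      Subgroup.mem_center_iff.1 (inv_mem hγ) x]

/-- **The Hecke operator of `(ι γ)⁻¹` is the identity on `H^i(X_L, M)`** for `γ ∈ Z(Γ)` with
`ι γ ∈ Z(𝒢)` (central elements of `Γ` act trivially on `H^i(Γ, ·)`). [folklore] -/
theorem heckeEnd_inv_eq_id_of_central {γ : Γ} (hγ : γ ∈ Subgroup.center Γ) (hγ' : ι γ ∈ Subgroup.center 𝒢)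
    (i : ℕ) : ArithmeticQuotient.heckeEnd k L (ι γ)⁻¹ M ι i = LinearMap.id := by
  have h := map_eq_id_of_central (ArithmeticQuotient.coeffRep k ι L M) hγ
    (ArithmeticQuotient.heckeRepHom k L (ι γ)⁻¹ M ι) (heckeRepHom_hom_apply_of_central k ι L M hγ') i
  unfold ArithmeticQuotient.heckeEnd ArithmeticQuotient.heckeOperator
  rw [h]
  exact ModuleCat.hom_id

/-- **The Hecke operator of `ι γ` is the identity on `H^i(X_L, M)`** for `γ ∈ Z(Γ)` with
`ι γ ∈ Z(𝒢)`. [folklore] -/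
theorem heckeEnd_eq_id_of_central {γ : Γ} (hγ : γ ∈ Subgroup.center Γ) (hγ' : ι γ ∈ Subgroup.center 𝒢)
    (i : ℕ) : ArithmeticQuotient.heckeEnd k L (ι γ) M ι i = LinearMap.id := by
  have h := heckeEnd_inv_eq_id_of_central k ι L M (inv_mem hγ) (by rw [map_inv]; exact inv_mem hγ') i
  rwa [map_inv, inv_inv] at h

end Generic

/-! ### Global scalars on the Hida tower of `GL_n` -/

section GLn

variable {n : ℕ} {K : Type} [Field K] [NumberField K] {p : ℕ} [Fact p.Prime] (𝒰 : TameLevel n K p)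
  (k : Type) [CommRing k]

omit [NumberField K] in
/-- Scalar matrices are central in `GL_n(K)`. [folklore] -/
theorem glScalar_mem_center (u : Kˣ) :
    Matrix.GeneralLinearGroup.scalar (Fin n) u ∈ Subgroup.center (GL (Fin n) K) :=
  Subgroup.mem_center_iff.2 fun g => (Matrix.GeneralLinearGroup.scalar_commute u g).symm

/-- The diagonal image of a global scalar matrix is the (central) scalar matrix of the principal
adele. [folklore] -/
theorem globalEmbedding_scalar (u : Kˣ) :
    globalEmbedding n K (Matrix.GeneralLinearGroup.scalar (Fin n) u) =
      Matrix.GeneralLinearGroup.scalar (Fin n)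
        (Units.map (algebraMap K (IsDedekindDomain.FiniteAdeleRing (NumberField.RingOfIntegers K) K) :
          K →* IsDedekindDomain.FiniteAdeleRing (NumberField.RingOfIntegers K) K) u) :=
  Matrix.GeneralLinearGroup.map_scalar _ u

/-- The diagonal image of a global scalar matrix is central in `GL_n(𝔸_K^∞)`. [folklore] -/
theorem globalEmbedding_scalar_mem_center (u : Kˣ) :
    globalEmbedding n K (Matrix.GeneralLinearGroup.scalar (Fin n) u) ∈ Subgroup.center (FiniteAdelicGL n K) := by
  rw [globalEmbedding_scalar]
  exact Subgroup.mem_center_iff.2 fun g => (Matrix.GeneralLinearGroup.scalar_commute _ g).symm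

/-- **Global central elements act trivially on the cohomology of the Hida tower**: for a global
scalar `u ∈ Kˣ`, the Hecke family of `γ = u · 1 ∈ GL_n(K) ⊂ GL_n(𝔸_K^∞)` on all the
`H^i(X_{U(r)}, k/p^s)` is `1`. [folklore] -/
theorem hidaFamily_globalEmbedding_scalar (u : Kˣ) :
    𝒰.hidaFamily k (globalEmbedding n K (Matrix.GeneralLinearGroup.scalar (Fin n) u)) = 1 := by
  funext x
  rw [TameLevel.hidaFamily_apply]
  exact heckeEnd_eq_id_of_central k (globalEmbedding n K) (𝒰.hidaLevel x.2.1) (modPow k (p : k) x.2.2)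
    (glScalar_mem_center u) (globalEmbedding_scalar_mem_center u) x.1

end GLn

end Literature.NumberTheory.Automorphic
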